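import Summits.Schanuel.Schanuel.Theorems.RootDecomp1KHyper48

/-!
# RootDecomp1KHyper — lens 6, generation 16/17 «ALGEBRAIC-LATTICE-ANCHORED CELL» (AlgLatAnchor.lean edition 2 42f80a0c…, 1588 l) — continuation (RootDecomp1KHyper49): §E THE RESULTANT ENGINE `no_int_relation_of_mvWeakMeasure_hyperAlgLat` (no named fact; ω an algebraic integer of ANY degree) + `algebraicIndependent_option_of_mvWeakMeasure_hyperAlgLat`

(lens-6 g16/g17 `AlgLatAnchor.lean` edition 2, sha256 42f80a0c…8416, own farm rc 0 · 0 sorry · axioms std; critic VERDICT STATUS L1677 / L1713 PORT GO LOW;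
port by census-1 gen 15 in six parts `RootDecomp1KHyper47`–`52` — see the PORT NOTE of part 47; `--supports stmt-Schanuel-33363`; rung 0.)
-/

open Complex IntermediateField Polynomial

namespace Summit.Schanuel.Schanuel.Theorems.RootDecomp1KHyper

namespace HyperCell

namespace LatCell

variable {n : ℕ}
open Summit.Schanuel.Schanuel.Theorems.RootDecomp1KGeneric (HasHLPairInSpan Rank3SpanResidual
  mem_adjoin_of_mem_span cexp_mem_adjoin_of_mem_span)

/-- `exp(−x) ≤ 1/x` for `x > 0`. -/
private theorem exp_neg_le_one_div₄ {x : ℝ} (hx : 0 < x) : Real.exp (-x) ≤ 1 / x := by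
  rw [Real.exp_neg, ← one_div]
  exact one_div_le_one_div_of_le hx (by linarith [Real.add_one_le_exp x])

/-- Near a complex point `y`, a nonzero complex polynomial has no root other than (possibly) `y`. -/
private theorem exists_ball_eval_ne_zeroC₄ (μ : ℂ[X]) (hμ : μ ≠ 0) (y : ℂ) :
    ∃ δ : ℝ, 0 < δ ∧ ∀ w : ℂ, w ≠ y → ‖w - y‖ < δ → μ.eval w ≠ 0 := by
  have hfin : {x : ℂ | μ.IsRoot x}.Finite := Polynomial.finite_setOf_isRoot hμ
  set T : Set ℂ := {x : ℂ | μ.IsRoot x} \ {y} with hT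
  have hTfin : T.Finite := hfin.sdiff
  have hopen : Tᶜ ∈ nhds y := hTfin.isClosed.isOpen_compl.mem_nhds fun h => h.2 rfl
  obtain ⟨δ, hδ, hball⟩ := Metric.mem_nhds_iff.mp hopen
  refine ⟨δ, hδ, fun w hw hwδ hroot => ?_⟩
  have hwT : w ∈ T := ⟨hroot, hw⟩
  have hwb : w ∈ Metric.ball y δ := by rw [Metric.mem_ball, dist_eq_norm]; exact hwδ
  exact hball hwb hwT

/-- Lipschitz bound at a complex root: `‖μ(w)‖ ≤ M ‖w − y‖` for `‖w − y‖ ≤ 1`. -/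
private theorem exists_lipschitz_at_rootC₄ (μ : ℂ[X]) (y : ℂ) (hroot : μ.eval y = 0) :
    ∃ M : ℝ, 0 < M ∧ ∀ w : ℂ, ‖w - y‖ ≤ 1 → ‖μ.eval w‖ ≤ M * ‖w - y‖ := by
  set ν := μ /ₘ (X - C y) with hν
  have hdvd : (X - C y) * ν = μ := Polynomial.mul_divByMonic_eq_iff_isRoot.mpr hroot
  obtain ⟨M₀, hM₀⟩ := (isCompact_closedBall y 1).exists_bound_of_continuousOn
    (Polynomial.continuous ν).continuousOn
  refine ⟨max M₀ 0 + 1, by positivity, fun w hw => ?_⟩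
  have hmem : w ∈ Metric.closedBall y 1 := by rw [Metric.mem_closedBall, dist_eq_norm]; exact hw
  have h1 : μ.eval w = (w - y) * ν.eval w := by
    conv_lhs => rw [← hdvd]
    rw [eval_mul, eval_sub, eval_X, eval_C]
  rw [h1, norm_mul]
  calc ‖w - y‖ * ‖ν.eval w‖ ≤ ‖w - y‖ * M₀ := by gcongr; exact hM₀ _ hmem
    _ ≤ ‖w - y‖ * (max M₀ 0 + 1) := by gcongr; linarith [le_max_left M₀ 0]
    _ = (max M₀ 0 + 1) * ‖w - y‖ := mul_comm _ _

/-- Norm of a product over a multiset with factors of norm `≤ b`. -/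
private theorem norm_multiset_prod_map_le (s : Multiset ℂ) (g : ℂ → ℂ) {b : ℝ} (hb : 0 ≤ b)
    (h : ∀ r ∈ s, ‖g r‖ ≤ b) : ‖(s.map g).prod‖ ≤ b ^ Multiset.card s := by
  induction s using Multiset.induction_on with
  | empty => simp
  | cons a s ih =>
    rw [Multiset.map_cons, Multiset.prod_cons, Multiset.card_cons, pow_succ, norm_mul, mul_comm]
    exact mul_le_mul (ih fun r hr => h r (Multiset.mem_cons_of_mem hr)) (h a (Multiset.mem_cons_self a s))
      (norm_nonneg _) (pow_nonneg hb _)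

set_option maxHeartbeats 4000000 in
/-- **Algebraic-lattice extraction engine (kernel; the new lever).**  Let `θ` carry an `MvWeakMeasure`,
let `ω` be an ALGEBRAIC INTEGER (minimal polynomial `f ∈ ℤ[T]`, monic irreducible of degree `d`), and
let `y` be hyper-approximable from the lattice `ℤ·1 + ℤ·ω` (`HyperLatApprox 1 ω y`).  Then there is NO relation `Σ_{k ≤ K} G_k(θ) y^k = 0` with
`G_k ∈ ℤ[x⃗]` not all zero.  Proof: the norm `N = Res_T(f, Q) ∈ ℤ[x⃗]` of the specialisation
`Q = Σ_k G_k (A + BT)^k E^{K−k}` at an approximant `x = (A + Bω)/E` is a nonzero integer polynomial of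
controlled degree and length, polynomial in the height, whose value at `θ` is hyper-small (module
docstring, (i)–(iv)). -/
theorem no_int_relation_of_mvWeakMeasure_hyperAlgLat {θ : Fin n → ℂ}
    (hθ : MvWeakMeasure θ) {ω : ℂ} (hint : IsIntegral ℤ ω) {y : ℂ} (hy : HyperLatApprox 1 ω y)
    {K : ℕ} (G : Fin (K + 1) → MvPolynomial (Fin n) ℤ) (hG : ∃ k, G k ≠ 0)
    (hrel : ∑ k : Fin (K + 1), MvPolynomial.aeval θ (G k) * y ^ (k : ℕ) = 0) : False := by
  classical
  -- the minimal polynomial f ∈ ℤ[T] of the algebraic integer ω (monic, irreducible)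
  set f : ℤ[X] := minpoly ℤ ω with hfdef
  have hfm : f.Monic := minpoly.monic hint
  have hfi : Irreducible f := minpoly.irreducible hint
  have hω : Polynomial.aeval ω f = 0 := minpoly.aeval ℤ ω
  -- the complex polynomial μ(Y) = Σ_k G_k(θ) Y^k, its isolated root y
  set μ : ℂ[X] := ∑ k : Fin (K + 1), C (MvPolynomial.aeval θ (G k)) * X ^ (k : ℕ) with hμdef
  have hμeval : ∀ w : ℂ, μ.eval w =
      ∑ k : Fin (K + 1), MvPolynomial.aeval θ (G k) * w ^ (k : ℕ) := by
    intro w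
    simp only [hμdef, eval_finsetSum, eval_mul, eval_C, eval_pow, eval_X]
  have hμcoeff : ∀ k : Fin (K + 1), μ.coeff k = MvPolynomial.aeval θ (G k) := by
    intro k
    simp only [hμdef, finsetSum_coeff, coeff_C_mul, coeff_X_pow]
    rw [Finset.sum_eq_single k]
    · simp
    · intro j _ hjk
      have : (k : ℕ) ≠ (j : ℕ) := fun h => hjk (Fin.ext h).symm
      simp [this]
    · intro h; exact absurd (Finset.mem_univ k) h
  have hμ0 : μ ≠ 0 := by
    obtain ⟨k, hk⟩ := hG
    intro h0
    have h1 : μ.coeff k = 0 := by rw [h0, coeff_zero]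
    rw [hμcoeff] at h1
    exact mvaeval_ne_zero_of_mvWeakMeasure hθ hk h1
  have hroot : μ.eval y = 0 := by rw [hμeval]; exact hrel
  obtain ⟨δ, hδ, hδroot⟩ := exists_ball_eval_ne_zeroC₄ μ hμ0 y
  obtain ⟨L, hL, hLip⟩ := exists_lipschitz_at_rootC₄ μ y hroot
  -- the conjugates of ω
  set fC : ℂ[X] := f.map (algebraMap ℤ ℂ) with hfCdef
  have hfCm : fC.Monic := hfm.map _
  have hfC0 : fC ≠ 0 := hfCm.ne_zero
  set d : ℕ := fC.natDegree with hddef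
  have hmem_roots : ∀ r : ℂ, r ∈ fC.roots ↔ Polynomial.aeval r f = 0 := by
    intro r
    rw [Polynomial.mem_roots hfC0, Polynomial.IsRoot.def, hfCdef, Polynomial.eval_map,
      ← Polynomial.aeval_def]
  have hωr : ω ∈ fC.roots := (hmem_roots ω).mpr hω
  have hcard : Multiset.card fC.roots ≤ d := Polynomial.card_roots' fC
  have hnn : ∀ x ∈ fC.roots.map (fun r => ‖r‖), (0 : ℝ) ≤ x := by
    intro x hx
    obtain ⟨r, _, rfl⟩ := Multiset.mem_map.mp hx
    exact norm_nonneg _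
  set ρ : ℝ := 1 + (fC.roots.map fun r => ‖r‖).sum with hρdef
  have hρsum : 0 ≤ (fC.roots.map fun r => ‖r‖).sum := Multiset.sum_nonneg hnn
  have hρ1 : 1 ≤ ρ := by rw [hρdef]; linarith only [hρsum]
  have hρ0 : 0 ≤ ρ := by linarith only [hρ1]
  have hrρ : ∀ r ∈ fC.roots, ‖r‖ ≤ ρ := by
    intro r hr
    have h1 : ‖r‖ ≤ (fC.roots.map fun r => ‖r‖).sum :=
      Multiset.single_le_sum hnn _ (Multiset.mem_map_of_mem _ hr)
    rw [hρdef]; linarith only [h1]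
  -- degrees, the measure, lengths
  set Dg : ℕ := Finset.univ.sup fun k : Fin (K + 1) => (G k).totalDegree with hDgdef
  have hDg : ∀ k, (G k).totalDegree ≤ Dg := fun k =>
    Finset.le_sup (f := fun k : Fin (K + 1) => (G k).totalDegree) (Finset.mem_univ k)
  set Dt : ℕ := (d + K) * Dg with hDtdef
  obtain ⟨Cm, kk, hCm, hmeas⟩ := hθ Dt
  set Hf : ℤ := ∑ i ∈ Finset.range (f.natDegree + 1), |f.coeff i| with hHfdef
  have hHf0 : 0 ≤ Hf := Finset.sum_nonneg fun _ _ => abs_nonneg _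
  have hfcoeff : ∀ t, |f.coeff t| ≤ Hf := by
    intro t
    by_cases ht : t < f.natDegree + 1
    · exact Finset.single_le_sum (f := fun i => |f.coeff i|) (fun _ _ => abs_nonneg _)
        (Finset.mem_range.mpr ht)
    · rw [Polynomial.coeff_eq_zero_of_natDegree_lt (by omega), abs_zero]; exact hHf0
  set Λ : ℤ := ∑ k, mvlen (G k) with hΛdef
  have hΛ : 0 ≤ Λ := Finset.sum_nonneg fun _ _ => mvlen_nonneg _
  set B₀ : ℤ := Hf + ((K + 1 : ℕ) : ℤ) * Λ with hB₀def
  have hB₀ : 0 ≤ B₀ := by rw [hB₀def]; positivity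
  have hHfB₀ : Hf ≤ B₀ := by rw [hB₀def]; nlinarith only [hΛ]
  set Γ : ℝ := ∑ k : Fin (K + 1), ‖MvPolynomial.aeval θ (G k)‖ with hΓdef
  have hΓ : 0 ≤ Γ := Finset.sum_nonneg fun _ _ => norm_nonneg _
  set M₂ : ℝ := Γ * ρ ^ K with hM₂def
  have hM₂ : 0 ≤ M₂ := by positivity
  -- constants (independent of the approximant)
  set c₀ : ℝ := ((Nat.factorial (d + K) : ℕ) : ℝ) * ((B₀ : ℤ) : ℝ) ^ (d + K) with hc₀def
  have hc₀ : 0 ≤ c₀ := by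
    have : (0 : ℝ) ≤ ((B₀ : ℤ) : ℝ) := by exact_mod_cast hB₀
    positivity
  set c₁ : ℝ := Cm * c₀ ^ kk with hc₁def
  set c₂ : ℝ := L * (1 + M₂) ^ d with hc₂def
  have hc₁ : 0 ≤ c₁ := by positivity
  have hc₂ : 0 ≤ c₂ := by positivity
  set e₁ : ℕ := 4 * K * (d + K) * kk with he₁
  set K₂ : ℕ := K + 2 * K * d with hK₂def
  set N₀ : ℕ := ⌈c₁ + c₂ + δ⁻¹⌉₊ + 1 with hNdef
  set m : ℕ := e₁ + K₂ + N₀ with hmdef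
  have hδinv : 0 < δ⁻¹ := inv_pos.mpr hδ
  have hNgt : c₁ + c₂ + δ⁻¹ < N₀ := by
    have h1 : c₁ + c₂ + δ⁻¹ ≤ ⌈c₁ + c₂ + δ⁻¹⌉₊ := Nat.le_ceil _
    rw [hNdef]; push_cast; linarith only [h1]
  have hN2 : (N₀ : ℝ) ≤ (2 : ℝ) ^ N₀ := by
    have h := (Nat.lt_two_pow_self (n := N₀)).le
    have h' : ((N₀ : ℕ) : ℝ) ≤ ((2 ^ N₀ : ℕ) : ℝ) := Nat.cast_le.mpr h
    simpa using h'
  -- the approximation x = (A + Bω)/E of height X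
  obtain ⟨A, B, E, hE, hne, hlt⟩ := hy m
  have hE1 : (1 : ℝ) ≤ E := by exact_mod_cast hE
  have hEpos : (0 : ℝ) < E := by exact_mod_cast hE
  have hE0 : E ≠ 0 := by omega
  have hEC : (E : ℂ) ≠ 0 := by exact_mod_cast hE0
  set Xr : ℝ := 1 + (E : ℝ) + |(A : ℝ)| + |(B : ℝ)| with hXdef
  set XZ : ℤ := 1 + (E : ℤ) + |A| + |B| with hXZdef
  have hXZ : ((XZ : ℤ) : ℝ) = Xr := by rw [hXZdef, hXdef]; push_cast; ring
  have hX2 : 2 ≤ Xr := by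
    rw [hXdef]; linarith only [hE1, abs_nonneg (A : ℝ), abs_nonneg (B : ℝ)]
  have hX1 : 1 ≤ Xr := by linarith only [hX2]
  have hX0 : 0 < Xr := by linarith only [hX2]
  have hEX : (E : ℝ) ≤ Xr := by
    rw [hXdef]; linarith only [abs_nonneg (A : ℝ), abs_nonneg (B : ℝ)]
  have hABX : |(A : ℝ)| + |(B : ℝ)| ≤ Xr := by rw [hXdef]; linarith only [hEpos]
  have hXZ2 : 2 ≤ XZ := by
    rw [hXZdef]; linarith only [show (1 : ℤ) ≤ E by exact_mod_cast hE, abs_nonneg A, abs_nonneg B]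
  have hXZ1 : 1 ≤ XZ := by linarith only [hXZ2]
  have hXZ0 : 0 ≤ XZ := by linarith only [hXZ2]
  have hEXZ : (E : ℤ) ≤ XZ := by rw [hXZdef]; linarith only [abs_nonneg A, abs_nonneg B]
  have hAXZ : |A| ≤ XZ := by
    rw [hXZdef]; linarith only [show (0 : ℤ) ≤ E by positivity, abs_nonneg B]
  have hBXZ : |B| ≤ XZ := by
    rw [hXZdef]; linarith only [show (0 : ℤ) ≤ E by positivity, abs_nonneg A]
  set β : ℂ := ((A : ℂ) * 1 + (B : ℂ) * ω) / (E : ℂ) with hβdef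
  set ε : ℝ := Real.exp (-(Xr ^ m)) with hεdef
  have hε0 : 0 < ε := Real.exp_pos _
  have hXe : ∀ e : ℕ, 1 ≤ Xr ^ e := fun e => one_le_pow₀ hX1
  have hXm : Xr ^ m = Xr ^ N₀ * Xr ^ e₁ * Xr ^ K₂ := by rw [hmdef, pow_add, pow_add]; ring
  have hXN : (N₀ : ℝ) ≤ Xr ^ N₀ := hN2.trans (pow_le_pow_left₀ (by norm_num) hX2 N₀)
  have hXm_gt : δ⁻¹ < Xr ^ m := by
    have h1 : Xr ^ N₀ ≤ Xr ^ m := by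
      rw [hXm]
      calc Xr ^ N₀ = Xr ^ N₀ * 1 * 1 := by ring
        _ ≤ Xr ^ N₀ * Xr ^ e₁ * Xr ^ K₂ := by gcongr <;> exact hXe _
    linarith only [h1, hXN, hNgt, hc₁, hc₂]
  have hεδ : ε < δ := by
    calc ε < Real.exp (-δ⁻¹) := Real.exp_lt_exp.mpr (by linarith only [hXm_gt])
      _ ≤ 1 / δ⁻¹ := exp_neg_le_one_div₄ hδinv
      _ = δ := by rw [one_div, inv_inv]
  have hε1 : ε ≤ 1 := by
    rw [hεdef]; exact Real.exp_le_one_iff.mpr (by linarith only [hXe m])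
  have hyβ : ‖β - y‖ < ε := by rw [norm_sub_rev]; exact hlt
  have hyβ1 : ‖β - y‖ ≤ 1 := by linarith only [hyβ, hε1]
  have hyβδ : ‖β - y‖ < δ := by linarith only [hyβ, hεδ]
  have hβne : β ≠ y := fun h => hne h.symm
  -- (1) μ(β) ≠ 0 and the Lipschitz bound
  have hμβ : μ.eval β ≠ 0 := hδroot β hβne hyβδ
  have hμβle : ‖μ.eval β‖ ≤ L * ε :=
    (hLip β hyβ1).trans (mul_le_mul_of_nonneg_left hyβ.le hL.le)
  have hsplit : ∀ k : Fin (K + 1), (E : ℂ) ^ K = (E : ℂ) ^ (k : ℕ) * (E : ℂ) ^ (K - k) := by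
    intro k
    rw [← pow_add, Nat.add_sub_of_le (Nat.lt_succ_iff.mp k.2)]
  have hEinv : ∀ k : Fin (K + 1), (E : ℂ) ^ (k : ℕ) * ((E : ℂ) ^ (k : ℕ))⁻¹ = 1 := fun k =>
    mul_inv_cancel₀ (pow_ne_zero _ hEC)
  -- (2) the specialisation Q(θ', r) = Σ_k G_k(θ') (A + B r)^k E^{K-k} and its value at (θ, ω)
  have hqω : qev G A B E θ ω = (E : ℂ) ^ K * μ.eval β := by
    simp only [qev]
    rw [hμeval, Finset.mul_sum]
    refine Finset.sum_congr rfl fun k _ => ?_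
    rw [hβdef, mul_one, div_pow, hsplit k, div_eq_mul_inv]
    linear_combination (-((E : ℂ) ^ (K - k) * MvPolynomial.aeval θ (G k) *
      ((A : ℂ) + (B : ℂ) * ω) ^ (k : ℕ))) * hEinv k
  have hqωle : ‖qev G A B E θ ω‖ ≤ Xr ^ K * (L * ε) := by
    rw [hqω, norm_mul, norm_pow, Complex.norm_natCast]
    exact mul_le_mul (pow_le_pow_left₀ hEpos.le hEX K) hμβle (norm_nonneg _) (by positivity)
  have hpowK : ∀ (t : ℝ), 0 ≤ t → t ≤ Xr → ∀ e : ℕ, e ≤ K → t ^ e ≤ Xr ^ K := by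
    intro t ht htX e he
    calc t ^ e ≤ Xr ^ e := pow_le_pow_left₀ ht htX e
      _ ≤ Xr ^ K := pow_le_pow_right₀ hX1 he
  have hqbound : ∀ r ∈ fC.roots, ‖qev G A B E θ r‖ ≤ (1 + M₂) * Xr ^ (2 * K) := by
    intro r hr
    have hr1 : ‖(A : ℂ) + (B : ℂ) * r‖ ≤ Xr * ρ := by
      calc ‖(A : ℂ) + (B : ℂ) * r‖ ≤ ‖(A : ℂ)‖ + ‖(B : ℂ) * r‖ := norm_add_le _ _
        _ = |(A : ℝ)| + |(B : ℝ)| * ‖r‖ := by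
            rw [norm_mul, Complex.norm_intCast, Complex.norm_intCast]
        _ ≤ |(A : ℝ)| * ρ + |(B : ℝ)| * ρ :=
            add_le_add (le_mul_of_one_le_right (abs_nonneg _) hρ1)
              (mul_le_mul_of_nonneg_left (hrρ r hr) (abs_nonneg _))
        _ = (|(A : ℝ)| + |(B : ℝ)|) * ρ := by ring
        _ ≤ Xr * ρ := mul_le_mul_of_nonneg_right hABX hρ0
    have hXρ1 : 1 ≤ Xr * ρ := one_le_mul_of_one_le_of_one_le hX1 hρ1
    calc ‖qev G A B E θ r‖ ≤ ∑ k : Fin (K + 1), ‖MvPolynomial.aeval θ (G k) *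
            (((A : ℂ) + (B : ℂ) * r) ^ (k : ℕ) * (E : ℂ) ^ (K - k))‖ := by
          simp only [qev]; exact norm_sum_le _ _
      _ ≤ ∑ k : Fin (K + 1), ‖MvPolynomial.aeval θ (G k)‖ * ((Xr * ρ) ^ K * Xr ^ K) := by
          refine Finset.sum_le_sum fun k _ => ?_
          rw [norm_mul, norm_mul, norm_pow, norm_pow, Complex.norm_natCast]
          refine mul_le_mul_of_nonneg_left ?_ (norm_nonneg _)
          have hk : (k : ℕ) ≤ K := Nat.lt_succ_iff.mp k.2
          refine mul_le_mul ?_ (hpowK _ hEpos.le hEX _ (Nat.sub_le _ _)) (by positivity)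
            (by positivity)
          calc ‖(A : ℂ) + (B : ℂ) * r‖ ^ (k : ℕ) ≤ (Xr * ρ) ^ (k : ℕ) :=
                pow_le_pow_left₀ (norm_nonneg _) hr1 _
            _ ≤ (Xr * ρ) ^ K := pow_le_pow_right₀ hXρ1 hk
      _ = M₂ * Xr ^ (2 * K) := by
          rw [hM₂def, hΓdef, Finset.sum_mul, Finset.sum_mul, mul_pow, two_mul, pow_add]
          exact Finset.sum_congr rfl fun k _ => by ring
      _ ≤ (1 + M₂) * Xr ^ (2 * K) :=
          mul_le_mul_of_nonneg_right (by linarith only [hM₂]) (by positivity)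
  -- (3)–(5) the polynomial Q ∈ ℤ[x⃗][T] (`engQ`), its coefficient bounds, the norm N = Res_T(f, Q) and the
  -- product formula — the named lemmas of §E0 (edition 2)
  have hQdeg : (engQ G A B E).natDegree ≤ K := engQ_natDegree_le G A B E
  have hB₀' : ((K + 1 : ℕ) : ℤ) * Λ ≤ B₀ := by rw [hB₀def]; linarith only [hHf0]
  set Bent : ℤ := B₀ * XZ ^ (4 * K) with hBentdef
  have hXZ4 : 1 ≤ XZ ^ (4 * K) := one_le_pow₀ hXZ1
  have hBent0 : 0 ≤ Bent := by rw [hBentdef]; positivity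
  have hQbd : ∀ t, mvlen ((engQ G A B E).coeff t) ≤ Bent ∧
      ((engQ G A B E).coeff t).totalDegree ≤ Dg := fun t =>
    engQ_coeff_bound G A B E hXZ2 hAXZ hBXZ hEXZ hDg hB₀' t
  set fA : Polynomial (MvPolynomial (Fin n) ℤ) :=
    f.map (algebraMap ℤ (MvPolynomial (Fin n) ℤ)) with hfAdef
  have hfAcoeff : ∀ t, fA.coeff t = MvPolynomial.C (f.coeff t) := by
    intro t; rw [hfAdef, Polynomial.coeff_map, MvPolynomial.algebraMap_eq]
  have hfAbd : ∀ t, mvlen (fA.coeff t) ≤ Bent ∧ (fA.coeff t).totalDegree ≤ Dg := by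
    intro t
    rw [hfAcoeff, mvlen_C, MvPolynomial.totalDegree_C]
    refine ⟨(hfcoeff t).trans (hHfB₀.trans ?_), Nat.zero_le _⟩
    rw [hBentdef]; exact le_mul_of_one_le_right hB₀ hXZ4
  set N : MvPolynomial (Fin n) ℤ := Polynomial.resultant fA (engQ G A B E) d K with hNdef'
  have hNbd := resultant_bounds fA (engQ G A B E) d K hBent0 hfAbd hQbd
  have hdegN : N.totalDegree ≤ Dt := hNbd.2
  have hlenN : mvlen N ≤ (Nat.factorial (d + K) : ℤ) * Bent ^ (d + K) := hNbd.1
  have hres : ∀ θ' : Fin n → ℂ, MvPolynomial.aeval θ' N = (fC.roots.map (qev G A B E θ')).prod :=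
    fun θ' => aeval_resultant_engQ G A B E hfm hfCdef hddef θ'
  -- (6) N ≠ 0: else some factor Q(·, r) vanishes identically, and by conjugation so does Q(·, ω)
  have hN0 : N ≠ 0 := by
    intro hN
    have hq0 : qev G A B E θ ω = 0 :=
      qev_eq_zero_of_resultant_eq_zero G A B E hfm hfi hω hfCdef hddef θ hN
    rw [hqω] at hq0
    rcases mul_eq_zero.mp hq0 with h | h
    · exact pow_ne_zero K hEC h
    · exact hμβ h
  -- (7) the upper bound ‖N(θ)‖ ≤ c₂ X^{K₂} ε
  have hup : ‖MvPolynomial.aeval θ N‖ ≤ c₂ * Xr ^ K₂ * ε := by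
    rw [hres θ, ← Multiset.cons_erase hωr, Multiset.map_cons, Multiset.prod_cons, norm_mul]
    have hb1 : 1 ≤ (1 + M₂) * Xr ^ (2 * K) :=
      one_le_mul_of_one_le_of_one_le (by linarith only [hM₂]) (hXe _)
    have h2 : ∀ r ∈ fC.roots.erase ω, ‖qev G A B E θ r‖ ≤ (1 + M₂) * Xr ^ (2 * K) := fun r hr =>
      hqbound r (Multiset.mem_of_mem_erase hr)
    have h3 : ‖((fC.roots.erase ω).map (qev G A B E θ)).prod‖ ≤
        ((1 + M₂) * Xr ^ (2 * K)) ^ Multiset.card (fC.roots.erase ω) :=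
      norm_multiset_prod_map_le _ _ (by positivity) h2
    have hcard' : Multiset.card (fC.roots.erase ω) ≤ d :=
      (Multiset.card_erase_le).trans hcard
    have h4 : ((1 + M₂) * Xr ^ (2 * K)) ^ Multiset.card (fC.roots.erase ω) ≤
        ((1 + M₂) * Xr ^ (2 * K)) ^ d := pow_le_pow_right₀ hb1 hcard'
    calc ‖qev G A B E θ ω‖ * ‖((fC.roots.erase ω).map (qev G A B E θ)).prod‖
        ≤ (Xr ^ K * (L * ε)) * ((1 + M₂) * Xr ^ (2 * K)) ^ d :=
          mul_le_mul hqωle (h3.trans h4) (norm_nonneg _) (by positivity)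
      _ = c₂ * Xr ^ K₂ * ε := by
          rw [hc₂def, hK₂def, mul_pow, ← pow_mul, pow_add, mul_assoc 2 K d]
          ring
  -- (8) the lower bound from the measure: length of N is polynomial in X
  have hlen0 : (0 : ℝ) ≤ ((mvlen N : ℤ) : ℝ) := by exact_mod_cast mvlen_nonneg N
  have hlenR : ((mvlen N : ℤ) : ℝ) ≤ c₀ * Xr ^ (4 * K * (d + K)) := by
    have h1 : ((mvlen N : ℤ) : ℝ) ≤ (((Nat.factorial (d + K) : ℤ) * Bent ^ (d + K) : ℤ) : ℝ) := by
      exact_mod_cast hlenN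
    refine h1.trans (le_of_eq ?_)
    rw [hBentdef, hc₀def, ← hXZ]
    push_cast
    rw [mul_pow, ← pow_mul]
    ring
  have hlow : Real.exp (-(Cm * ((mvlen N : ℤ) : ℝ) ^ kk)) ≤ ‖MvPolynomial.aeval θ N‖ :=
    hmeas N hN0 hdegN
  have hc₁X : Cm * ((mvlen N : ℤ) : ℝ) ^ kk ≤ c₁ * Xr ^ e₁ := by
    have h1 : ((mvlen N : ℤ) : ℝ) ^ kk ≤ (c₀ * Xr ^ (4 * K * (d + K))) ^ kk :=
      pow_le_pow_left₀ hlen0 hlenR kk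
    have h2 : (c₀ * Xr ^ (4 * K * (d + K))) ^ kk = c₀ ^ kk * Xr ^ e₁ := by
      rw [he₁, mul_pow, ← pow_mul]
    calc Cm * ((mvlen N : ℤ) : ℝ) ^ kk ≤ Cm * (c₀ * Xr ^ (4 * K * (d + K))) ^ kk :=
          mul_le_mul_of_nonneg_left h1 hCm.le
      _ = c₁ * Xr ^ e₁ := by rw [h2, hc₁def]; ring
  have hlow' : Real.exp (-(c₁ * Xr ^ e₁)) ≤ ‖MvPolynomial.aeval θ N‖ :=
    (Real.exp_le_exp.mpr (neg_le_neg hc₁X)).trans hlow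
  -- (9) the clash
  have hchain : Real.exp (-(c₁ * Xr ^ e₁)) ≤ c₂ * Xr ^ K₂ * ε := hlow'.trans hup
  have hmain : c₁ * Xr ^ e₁ + c₂ * Xr ^ K₂ ≤ Xr ^ m := by
    rw [hXm]
    have h1 : c₁ * Xr ^ e₁ ≤ c₁ * (Xr ^ e₁ * Xr ^ K₂) := by
      apply mul_le_mul_of_nonneg_left _ hc₁
      calc Xr ^ e₁ = Xr ^ e₁ * 1 := (mul_one _).symm
        _ ≤ Xr ^ e₁ * Xr ^ K₂ := by gcongr; exact hXe _
    have h2 : c₂ * Xr ^ K₂ ≤ c₂ * (Xr ^ e₁ * Xr ^ K₂) := by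
      apply mul_le_mul_of_nonneg_left _ hc₂
      calc Xr ^ K₂ = 1 * Xr ^ K₂ := (one_mul _).symm
        _ ≤ Xr ^ e₁ * Xr ^ K₂ := by gcongr; exact hXe _
    have h3 : c₁ + c₂ ≤ Xr ^ N₀ := by linarith only [hNgt, hXN, hδinv]
    calc c₁ * Xr ^ e₁ + c₂ * Xr ^ K₂
        ≤ c₁ * (Xr ^ e₁ * Xr ^ K₂) + c₂ * (Xr ^ e₁ * Xr ^ K₂) := add_le_add h1 h2
      _ = (c₁ + c₂) * (Xr ^ e₁ * Xr ^ K₂) := by ring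
      _ ≤ Xr ^ N₀ * (Xr ^ e₁ * Xr ^ K₂) := mul_le_mul_of_nonneg_right h3 (by positivity)
      _ = Xr ^ N₀ * Xr ^ e₁ * Xr ^ K₂ := by ring
  have hlt2 : c₂ * Xr ^ K₂ * ε < Real.exp (-(c₁ * Xr ^ e₁)) := by
    have h1 : c₂ * Xr ^ K₂ < Real.exp (Xr ^ m - c₁ * Xr ^ e₁) := by
      have h2 := Real.add_one_le_exp (Xr ^ m - c₁ * Xr ^ e₁)
      linarith only [h2, hmain]
    have h3 : Real.exp (Xr ^ m - c₁ * Xr ^ e₁) * ε = Real.exp (-(c₁ * Xr ^ e₁)) := by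
      rw [hεdef, ← Real.exp_add]; congr 1; ring
    calc c₂ * Xr ^ K₂ * ε < Real.exp (Xr ^ m - c₁ * Xr ^ e₁) * ε :=
          mul_lt_mul_of_pos_right h1 hε0
      _ = Real.exp (-(c₁ * Xr ^ e₁)) := h3
  exact absurd hchain (not_le.mpr hlt2)

end LatCell

end HyperCell

end Summit.Schanuel.Schanuel.Theorems.RootDecomp1KHyper
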